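/-
Copyright (c) 2026 the pub-hodgecm-mathlib formalisation cell (harness21).  Prover seat hodgecm-mathlib-LH3-p02 (g5): line LH3 (closer stub `stub_N9`), LETTER L3′ SURJ-OF-FORWARD,
organ (Σ-WALL) — FILTRATION ROAD (W-ROAD CENSUS v1 6129001bfae4ccc0, RULING #26), brick (W3-G) part 2a: the CLASS-FUNCTION FACTORISATION at a split place.
-/
import Literature.NumberTheory.Automorphic.ArchEndoscopicChartOrbLocalSplitPlace  -- ★ `hasCompactSupport_descConj_endoBlockAt_of_mem` (compact support of the quotient integrand at split regular points)
import Literature.NumberTheory.Automorphic.ArchEndoscopicChartSplitDock          -- ★ `coe_endoBlockAt_of_mem` (the split chart point in coordinates)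
import Literature.NumberTheory.Automorphic.ArchRankOneSplitConeMatching          -- ★ `hasCompactSupport_comp_coe` (ambient compact support restricts to the closed group)
import Literature.Analysis.Calculus.WhitneyEvenFunction                           -- ★ Whitney even functions with parameters `contDiffOn_comp_sqrt_of_even`
import Literature.Analysis.Calculus.SeeleyExtension                               -- ★ Seeley `exists_contDiffOn_extension`
import Mathlib.Analysis.SpecialFunctions.Arsinh
import Mathlib.Analysis.SpecialFunctions.Complex.LogDeriv
import Mathlib.Analysis.Calculus.BumpFunction.FiniteDimension
import HarnessLib

/-!
# (W3-G), PART 2a: THE CLASS-FUNCTION FACTORISATION AT A SPLIT PLACE (Varadarajan 1989 §6.4; Rogawski 1990 §8.2; Whitney 1943)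

Topic `NumberTheory/Rogawski1990`; namespace `Literature.NumberTheory.Rogawski1990`.  THEOREMS ONLY (no `def`, no instance, no notation, no axiom, no named fact, no `sorry`).
Cell `pub/hodgecm-mathlib`, crux H413 (`stmt-HodgeConjecture-24833`), F0∕P3c line LH3 (closer stub `stub_N9`), LETTER L3′ SURJ-OF-FORWARD, organ (Σ-WALL) = `hwall` of ★
`bouazizSurjOfForward_of_reg_wall`, FILTRATION ROAD (W-ROAD CENSUS v1, LH3-p01 (g6); RULING #26): brick **(W3-G)** part 2a — the two tools the COMPACT-TYPE generator
`f^cp = F¹ − (ρ ∘ tr)·F¹κ` of part 2b (`ArchRankOneWallGenerators`) is built from: the smooth CLASS function `ρ` realising the ratio of two even split readings, and the algebra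
that factors a class-function multiple out of the local chart orbital functional at a split place.  Count-neutral.

WHAT IS PROVED.
* §1 (pure calculus) **`exists_contDiff_comp_trace_mul_eq_of_even`**: two smooth germs `G₁, G₂` EVEN in `x` with `G₂(0, θ₀) ≠ 0` ⇒ `∃ ρ ∈ C^∞(ℂ)`, `δ > 0` with
  `ρ (2 cosh x · e^{iθ}) · G₂ (x, θ) = G₁ (x, θ)` for `|x|, |θ − θ₀| < δ` — the quotient IS a smooth function of the class datum `tr diag(e^{x+iθ}, e^{−x+iθ})`
  (arsinh reparametrisation, Whitney's even-function theorem with parameters ★, Seeley extension ★, the smooth left inverse of the class datum, a bump).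
* §2 (reading algebra at a split place) `chartOrbHLoc_sub_traceMul_eq` — `chartOrbHLoc (f − (ρ ∘ tr)·g) = chartOrbHLoc f − ρ(tr(endoBlockAt)) · chartOrbHLoc g` at split regular points
  (`tr` is a class function; integrability by ★ `hasCompactSupport_descConj_endoBlockAt_of_mem`); `trace_coe_endoBlockAt_of_mem` (`= 2 cosh (cw 0) · e^{i cw 2}`).
HONEST LABEL: HC_CM is proved only modulo the 7 printed citations (2 remaining: hLiu418 = `stmt-HodgeConjecture-24832`, h413 = `stmt-HodgeConjecture-24833`) until rung 0 closes;
rank-one analysis over the ★ kit, pays nothing by itself.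

## References
* [Varadarajan1989] V. S. Varadarajan, *An Introduction to Harmonic Analysis on Semisimple Lie Groups*, Cambridge Stud. Adv. Math. 16 (1989), §6.4 Lemma 21, Thm 22, Thm 23.
* [Rogawski1990] J. D. Rogawski, *Automorphic Representations of Unitary Groups in Three Variables*, Ann. of Math. Stud. 123 (1990), §8.2 Prop. 8.2.1 p. 119, pp. 122–123; §3.6 p. 31.
* [Whitney1943] H. Whitney, *Differentiable even functions*, Duke Math. J. 10 (1943), Thm. 1.
-/

set_option autoImplicit false

noncomputable section

open MeasureTheory MeasureTheory.Measure Set Filter Topology NumberField NumberField.InfinitePlace Complex Function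
open scoped ENNReal NNReal ComplexConjugate Real MatrixGroups Matrix ContDiff Matrix.Norms.Operator

namespace Literature.NumberTheory.Rogawski1990

open Literature.NumberTheory.Automorphic Literature.NumberTheory.Automorphic.UnitaryGroup Literature.MeasureTheory.Group

/-! ## §1 Pure calculus: a quotient of even smooth germs is a smooth function of the class datum -/

section Calculus

/-- **CLASS-FUNCTION REALISATION OF A QUOTIENT OF EVEN SMOOTH GERMS.**  If `G₁, G₂ : ℝ × ℝ → ℂ` are `C^∞` and EVEN in the first variable and `G₂ (0, θ₀) ≠ 0`, there is a `C^∞`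
function `ρ : ℂ → ℂ` and `δ > 0` with `ρ (2 cosh x · e^{iθ}) · G₂ (x, θ) = G₁ (x, θ)` (and `G₂ (x, θ) ≠ 0`) for `|x| < δ`, `|θ − θ₀| < δ`: the quotient `G₁ ∕ G₂`, an even smooth germ
in the split coordinate `x`, IS a smooth function of the class datum `tr(diag(e^{x+iθ}, e^{−x+iθ})) = 2 cosh x · e^{iθ}`.  Road: reparametrise `x = arsinh y` (odd diffeomorphism), Whitney's
even-function theorem with parameters (★ `contDiffOn_comp_sqrt_of_even`: a function of `(y², θ)` on `{s ≥ 0}`), Seeley extension across `s = 0` (★ `Seeley.exists_contDiffOn_extension`),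
and the smooth left inverse `t ↦ (|t|²∕4 − 1, θ₀ + Im log (t · conj e^{iθ₀})) = (sinh² x, θ)` of the class datum near `2 e^{iθ₀}`, glued by a bump.
[cite: Whitney1943, Thm. 1] [cite: Varadarajan1989, §6.4 p. 229] -/
theorem exists_contDiff_comp_trace_mul_eq_of_even {G₁ G₂ : ℝ × ℝ → ℂ} (hG₁ : ContDiff ℝ ∞ G₁) (hG₂ : ContDiff ℝ ∞ G₂)
    (hev₁ : ∀ x θ, G₁ (-x, θ) = G₁ (x, θ)) (hev₂ : ∀ x θ, G₂ (-x, θ) = G₂ (x, θ)) (θ₀ : ℝ) (hne : G₂ (0, θ₀) ≠ 0) :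
    ∃ ρ : ℂ → ℂ, ContDiff ℝ ∞ ρ ∧ ∃ δ : ℝ, 0 < δ ∧ ∀ x θ : ℝ, |x| < δ → |θ - θ₀| < δ →
      G₂ (x, θ) ≠ 0 ∧ ρ (((2 * Real.cosh x : ℝ) : ℂ) * Complex.exp ((θ : ℂ) * Complex.I)) * G₂ (x, θ) = G₁ (x, θ) := by
  -- (1) the odd reparametrisation `x = arsinh y` and Whitney's even-function theorem for the pair `(G₁, G₂)`
  set F : ℝ × ℝ → ℂ × ℂ := fun p => (G₁ (Real.arsinh p.1, p.2), G₂ (Real.arsinh p.1, p.2)) with hF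
  have hars : ContDiff ℝ ∞ fun p : ℝ × ℝ => ((Real.arsinh p.1, p.2) : ℝ × ℝ) :=
    (Real.contDiff_arsinh.comp contDiff_fst).prodMk contDiff_snd
  have hFs : ContDiff ℝ ∞ F := (hG₁.comp hars).prodMk (hG₂.comp hars)
  have hFev : ∀ y (θ : ℝ), F (-y, θ) = F (y, θ) := by
    intro y θ
    simp only [hF, Real.arsinh_neg, hev₁, hev₂]
  have hW := Literature.Analysis.Calculus.contDiffOn_comp_sqrt_of_even hFs hFev
  -- (2) Seeley extension across `s = 0` near `(0, θ₀)`
  have hW' : ContDiffOn ℝ ∞ (fun p : ℝ × ℝ => F (Real.sqrt p.1, p.2)) (univ ∩ {p : ℝ × ℝ | 0 ≤ p.1}) := by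
    refine hW.mono ?_
    rintro p ⟨-, hp⟩
    exact ⟨hp, mem_univ _⟩
  obtain ⟨V, hVo, hV0, -, g, hg, hgF⟩ := Literature.Analysis.Calculus.Seeley.exists_contDiffOn_extension (x₀ := θ₀) isOpen_univ (mem_univ _) hW'
  have hg0 : g (0, θ₀) = (G₁ (0, θ₀), G₂ (0, θ₀)) := by
    rw [hgF ⟨hV0, show (0:ℝ) ≤ 0 from le_rfl⟩]
    simp [hF, Real.sqrt_zero, Real.arsinh_zero]
  -- the open set where the extended denominator is non-zero
  set V' : Set (ℝ × ℝ) := V ∩ (fun p => (g p).2) ⁻¹' {c : ℂ | c ≠ 0} with hV'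
  have hV'o : IsOpen V' := (continuous_snd.comp_continuousOn hg.continuousOn).isOpen_inter_preimage hVo isOpen_ne
  have hV'0 : ((0 : ℝ), θ₀) ∈ V' := ⟨hV0, by rw [mem_preimage, hg0]; exact hne⟩
  -- (3) the smooth left inverse of the class datum near `t₀ = 2 e^{iθ₀}`
  set z : ℂ := Complex.exp ((θ₀ : ℂ) * Complex.I) with hz
  set σ : ℂ → ℝ × ℝ := fun t => (Complex.normSq t / 4 - 1, θ₀ + (Complex.log (t * conj z)).im) with hσ
  set O₁ : Set ℂ := (fun t => t * conj z) ⁻¹' Complex.slitPlane with hO₁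
  have hO₁o : IsOpen O₁ := Complex.isOpen_slitPlane.preimage (continuous_id.mul continuous_const)
  have hσ_at : ∀ t ∈ O₁, ContDiffAt ℝ ∞ σ t := by
    intro t ht
    have h1 : ContDiffAt ℝ ∞ (fun t : ℂ => Complex.normSq t / 4 - 1) t := by
      have : ContDiff ℝ ∞ fun t : ℂ => Complex.normSq t := by
        have e : (fun t : ℂ => Complex.normSq t) = fun t => ‖t‖ ^ 2 := funext fun t => (Complex.sq_norm t).symm
        rw [e]; exact contDiff_norm_sq ℝ
      exact ((this.div_const 4).sub contDiff_const).contDiffAt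
    have h2 : ContDiffAt ℝ ∞ (fun t : ℂ => θ₀ + (Complex.log (t * conj z)).im) t := by
      have hl : ContDiffAt ℝ ∞ (fun t : ℂ => Complex.log (t * conj z)) t :=
        ((Complex.contDiffAt_log ht).restrict_scalars ℝ).comp t ((contDiff_id.mul contDiff_const).contDiffAt)
      exact contDiffAt_const.add (Complex.imCLM.contDiff.contDiffAt.comp t hl)
    exact h1.prodMk h2
  have hσc : ContinuousOn σ O₁ := fun t ht => (hσ_at t ht).continuousAt.continuousWithinAt
  set O : Set ℂ := O₁ ∩ σ ⁻¹' V' with hO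
  have hOo : IsOpen O := hσc.isOpen_inter_preimage hO₁o hV'o
  set t₀ : ℂ := 2 * z with ht₀
  have hzz : z * conj z = 1 := by
    rw [hz, ← Complex.exp_conj, map_mul, Complex.conj_ofReal, Complex.conj_I, mul_neg, ← Complex.exp_add, add_neg_cancel, Complex.exp_zero]
  have ht₀z : t₀ * conj z = 2 := by rw [ht₀, mul_assoc, hzz, mul_one]
  have hnz : Complex.normSq z = 1 := by
    rw [hz, ← Complex.sq_norm, Complex.norm_exp_ofReal_mul_I, one_pow]
  have hσt₀ : σ t₀ = (0, θ₀) := by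
    simp only [hσ, ht₀z]
    refine Prod.ext ?_ ?_
    · simp only [ht₀, map_mul, hnz, mul_one]
      norm_num [Complex.normSq_ofNat]
    · simp only
      rw [show (2 : ℂ) = ((2 : ℝ) : ℂ) by norm_num, Complex.log_im, Complex.arg_ofReal_of_nonneg (by norm_num), add_zero]
  have ht₀O : t₀ ∈ O := by
    refine ⟨?_, ?_⟩
    · show t₀ * conj z ∈ Complex.slitPlane
      rw [ht₀z]; exact Complex.mem_slitPlane_iff.2 (Or.inl (by norm_num))
    · rw [mem_preimage, hσt₀]; exact hV'0
  -- (4) the quotient on `O` and the glued class function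
  set H : ℂ → ℂ := fun t => (g (σ t)).1 * ((g (σ t)).2)⁻¹ with hH
  have hHO : ContDiffOn ℝ ∞ H O := by
    have hσO : ContDiffOn ℝ ∞ σ O := fun t ht => (hσ_at t ht.1).contDiffWithinAt
    have hgσ : ContDiffOn ℝ ∞ (fun t => g (σ t)) O := hg.comp hσO fun t ht => ht.2.1
    exact hgσ.fst.mul (hgσ.snd.inv fun t ht => ht.2.2)
  obtain ⟨r, hr, hrO⟩ := Metric.isOpen_iff.1 hOo t₀ ht₀O
  let χ : ContDiffBump t₀ := ⟨r / 4, r / 2, by positivity, by linarith⟩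
  have hχO : tsupport (χ : ℂ → ℝ) ⊆ O := by
    rw [χ.tsupport_eq]
    exact (Metric.closedBall_subset_ball (by show r / 2 < r; linarith)).trans hrO
  set ρ : ℂ → ℂ := fun t => ((χ t : ℝ) : ℂ) * H t with hρ
  have hρs : ContDiff ℝ ∞ ρ := by
    rw [contDiff_iff_contDiffAt]
    intro t
    by_cases ht : t ∈ O
    · exact ((Complex.ofRealCLM.contDiff.comp χ.contDiff).contDiffAt).mul ((hHO t ht).contDiffAt (hOo.mem_nhds ht))
    · have hχ0 : (χ : ℂ → ℝ) =ᶠ[𝓝 t] 0 := notMem_tsupport_iff_eventuallyEq.1 fun h => ht (hχO h)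
      have hρ0 : ρ =ᶠ[𝓝 t] fun _ => 0 := by
        filter_upwards [hχ0] with u hu
        simp only [hρ, hu, Pi.zero_apply, Complex.ofReal_zero, zero_mul]
      exact (contDiffAt_const (c := (0 : ℂ))).congr_of_eventuallyEq hρ0
  refine ⟨ρ, hρs, ?_⟩
  -- (5) the radius: the class datum `T(x, θ) = 2 cosh x · e^{iθ}` stays in the ball where `χ = 1`, and `|θ − θ₀| < π ∕ 2`
  have htc : Continuous fun p : ℝ × ℝ => ((2 * Real.cosh p.1 : ℝ) : ℂ) * Complex.exp ((p.2 : ℂ) * Complex.I) := by fun_prop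
  have ht0 : ((2 * Real.cosh ((0 : ℝ), θ₀).1 : ℝ) : ℂ) * Complex.exp (((((0 : ℝ), θ₀).2 : ℝ) : ℂ) * Complex.I) = t₀ := by
    simp only [Real.cosh_zero, mul_one, ht₀, hz]
    push_cast
    ring
  have hpre : (fun p : ℝ × ℝ => ((2 * Real.cosh p.1 : ℝ) : ℂ) * Complex.exp ((p.2 : ℂ) * Complex.I)) ⁻¹' Metric.ball t₀ (r / 4) ∈ 𝓝 ((0 : ℝ), θ₀) := by
    apply htc.continuousAt.preimage_mem_nhds
    rw [ht0]
    exact Metric.ball_mem_nhds _ (by positivity)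
  obtain ⟨δ₁, hδ₁, hball⟩ := Metric.mem_nhds_iff.1 hpre
  refine ⟨min (δ₁ / 2) (π / 2), lt_min (by positivity) (by positivity), fun x θ hx hθ => ?_⟩
  have hx' : |x| < δ₁ / 2 := lt_of_lt_of_le hx (min_le_left _ _)
  have hθ' : |θ - θ₀| < δ₁ / 2 := lt_of_lt_of_le hθ (min_le_left _ _)
  have hθπ : |θ - θ₀| < π / 2 := lt_of_lt_of_le hθ (min_le_right _ _)
  -- the class datum `T` lies in the small ball
  have hTball : ((2 * Real.cosh x : ℝ) : ℂ) * Complex.exp ((θ : ℂ) * Complex.I) ∈ Metric.ball t₀ (r / 4) := by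
    have hmem : ((x, θ) : ℝ × ℝ) ∈ Metric.ball ((0 : ℝ), θ₀) δ₁ := by
      rw [Metric.mem_ball, Prod.dist_eq, max_lt_iff]
      simp only [Real.dist_eq, sub_zero]
      exact ⟨by linarith [hx'], by linarith [hθ']⟩
    have h := hball hmem
    rw [Set.mem_preimage] at h
    simpa only using h
  have hTO : ((2 * Real.cosh x : ℝ) : ℂ) * Complex.exp ((θ : ℂ) * Complex.I) ∈ O := hrO (Metric.ball_subset_ball (by linarith) hTball)
  have hχT : (χ : ℂ → ℝ) (((2 * Real.cosh x : ℝ) : ℂ) * Complex.exp ((θ : ℂ) * Complex.I)) = 1 :=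
    χ.one_of_mem_closedBall (Metric.ball_subset_closedBall hTball)
  -- `σ(T) = (sinh² x, θ)`
  have hTz : ((2 * Real.cosh x : ℝ) : ℂ) * Complex.exp ((θ : ℂ) * Complex.I) * conj z =
      Complex.exp (((Real.log (2 * Real.cosh x) : ℝ) : ℂ) + ((θ - θ₀ : ℝ) : ℂ) * Complex.I) := by
    have hpos : 0 < 2 * Real.cosh x := by positivity
    rw [Complex.exp_add, ← Complex.ofReal_exp, Real.exp_log hpos, hz, ← Complex.exp_conj, map_mul, Complex.conj_ofReal, Complex.conj_I,
      mul_assoc, ← Complex.exp_add]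
    congr 2
    push_cast
    ring
  have him : ((((Real.log (2 * Real.cosh x) : ℝ) : ℂ) + ((θ - θ₀ : ℝ) : ℂ) * Complex.I)).im = θ - θ₀ := by
    simp only [Complex.add_im, Complex.ofReal_im, Complex.mul_im, Complex.ofReal_re, Complex.I_im, Complex.I_re, mul_one, mul_zero, zero_add, add_zero]
  have hσT : σ (((2 * Real.cosh x : ℝ) : ℂ) * Complex.exp ((θ : ℂ) * Complex.I)) = (Real.sinh x ^ 2, θ) := by
    refine Prod.ext ?_ ?_
    · show Complex.normSq (((2 * Real.cosh x : ℝ) : ℂ) * Complex.exp ((θ : ℂ) * Complex.I)) / 4 - 1 = Real.sinh x ^ 2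
      rw [map_mul, Complex.normSq_ofReal, ← Complex.sq_norm, Complex.norm_exp_ofReal_mul_I, one_pow, mul_one]
      nlinarith [Real.cosh_sq x]
    · show θ₀ + (Complex.log (((2 * Real.cosh x : ℝ) : ℂ) * Complex.exp ((θ : ℂ) * Complex.I) * conj z)).im = θ
      rw [hTz, Complex.log_exp, him]
      · ring
      · rw [him]; linarith [(abs_lt.1 hθπ).1, Real.pi_pos]
      · rw [him]; linarith [(abs_lt.1 hθπ).2, Real.pi_pos]
  -- `g (sinh² x, θ) = F (|sinh x|, θ) = (G₁ (x, θ), G₂ (x, θ))`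
  have hσTV : (Real.sinh x ^ 2, θ) ∈ V' := by
    have h2 : σ (((2 * Real.cosh x : ℝ) : ℂ) * Complex.exp ((θ : ℂ) * Complex.I)) ∈ V' := hTO.2
    rwa [hσT] at h2
  have hsx : (Real.sinh x ^ 2, θ) ∈ V ∩ {p : ℝ × ℝ | 0 ≤ p.1} := ⟨hσTV.1, show (0:ℝ) ≤ Real.sinh x ^ 2 from sq_nonneg _⟩
  have hgT : g (Real.sinh x ^ 2, θ) = (G₁ (x, θ), G₂ (x, θ)) := by
    rw [hgF hsx]
    simp only [hF, Real.sqrt_sq_eq_abs]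
    -- `arsinh |sinh x| = |x|`, then evenness
    have habs : Real.arsinh |Real.sinh x| = |x| := by
      rcases le_or_gt 0 x with h | h
      · rw [abs_of_nonneg (Real.sinh_nonneg_iff.2 h), abs_of_nonneg h, Real.arsinh_sinh]
      · rw [abs_of_neg (Real.sinh_neg_iff.2 h), abs_of_neg h, ← Real.sinh_neg, Real.arsinh_sinh]
    rw [habs]
    rcases le_or_gt 0 x with h | h
    · rw [abs_of_nonneg h]
    · rw [abs_of_neg h, hev₁, hev₂]
  have hG₂ne : G₂ (x, θ) ≠ 0 := by
    have h2 := hσTV.2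
    rw [mem_preimage, hgT] at h2
    exact h2
  refine ⟨hG₂ne, ?_⟩
  show ((((χ : ℂ → ℝ) (((2 * Real.cosh x : ℝ) : ℂ) * Complex.exp ((θ : ℂ) * Complex.I)) : ℝ) : ℂ) *
      ((g (σ (((2 * Real.cosh x : ℝ) : ℂ) * Complex.exp ((θ : ℂ) * Complex.I)))).1 * ((g (σ (((2 * Real.cosh x : ℝ) : ℂ) * Complex.exp ((θ : ℂ) * Complex.I)))).2)⁻¹)) *
      G₂ (x, θ) = G₁ (x, θ)
  rw [hχT, hσT, hgT]
  simp only [Complex.ofReal_one, one_mul]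
  field_simp

end Calculus

/-! ## §2 Reading algebra at a split place: a class-function multiple factors out of the local chart orbital functional -/

section Reading

variable (L : Type) [Field L] [NumberField L] [IsCMField L] (S : Finset {w : InfinitePlace L // IsComplex w}) {w : {w : InfinitePlace L // IsComplex w}}

omit [NumberField L] [IsCMField L] in
/-- **The trace of the split chart point**: `tr (endoBlockAt S w cw) = 2 cosh (cw 0) · e^{i cw 2}` at a split place `w ∈ S`. [cite: Rogawski1990, §3.6 p. 31] -/
theorem trace_coe_endoBlockAt_of_mem (hw : w ∈ S) (cw : Fin 3 → ℝ) :
    Matrix.trace (((endoBlockAt L S w cw : ↥(archLocal L 2 (Matrix.of fun i j : Fin 2 => if i.val + j.val + 1 = 2 then (1 : L) else 0) w)) : GL (Fin 2) ℂ) : Matrix (Fin 2) (Fin 2) ℂ) =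
      ((2 * Real.cosh (cw 0) : ℝ) : ℂ) * Complex.exp ((cw 2 : ℂ) * Complex.I) := by
  rw [coe_endoBlockAt_of_mem L S hw cw, coe_hypBlockGL, Matrix.trace_fin_two_of, Complex.ofReal_mul, Complex.ofReal_cosh]
  simp only [Complex.cosh, Complex.exp_add, Complex.exp_neg]
  push_cast
  field_simp

variable [MeasurableSpace ↥(archLocal L 2 (Matrix.of fun i j : Fin 2 => if i.val + j.val + 1 = 2 then (1 : L) else 0) w)]
  [BorelSpace ↥(archLocal L 2 (Matrix.of fun i j : Fin 2 => if i.val + j.val + 1 = 2 then (1 : L) else 0) w)]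
  (νw : Measure ↥(archLocal L 2 (Matrix.of fun i j : Fin 2 => if i.val + j.val + 1 = 2 then (1 : L) else 0) w)) [νw.IsHaarMeasure] [νw.IsMulRightInvariant]

omit [NumberField L] [IsCMField L] in
/-- **A CLASS-FUNCTION MULTIPLE FACTORS OUT OF THE LOCAL CHART ORBITAL FUNCTIONAL AT A SPLIT REGULAR POINT**: for `w ∈ S`, `cw 0 ≠ 0`, continuous compactly supported ambient `f, g`
and ANY `ρ : ℂ → ℂ`: `chartOrbHLoc (f − (ρ ∘ tr)·g) cw = chartOrbHLoc f cw − ρ (tr endoBlockAt) · chartOrbHLoc g cw` (the trace is constant on the class; both quotient integrands are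
integrable — continuous with compact support, ★ `hasCompactSupport_descConj_endoBlockAt_of_mem`). [cite: Rogawski1990, §8.2 p. 122] [cite: Varadarajan1989, §6.4 p. 229] -/
theorem chartOrbHLoc_sub_traceMul_eq (hw : w ∈ S) {cw : Fin 3 → ℝ} (hx : cw 0 ≠ 0) {f g : Matrix (Fin 2) (Fin 2) ℂ → ℂ} (hf : Continuous f) (hfc : HasCompactSupport f)
    (hg : Continuous g) (hgc : HasCompactSupport g) (ρ : ℂ → ℂ) :
    chartOrbHLoc L S w νw (fun k => f ((k : GL (Fin 2) ℂ) : Matrix (Fin 2) (Fin 2) ℂ) -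
        ρ (Matrix.trace ((k : GL (Fin 2) ℂ) : Matrix (Fin 2) (Fin 2) ℂ)) * g ((k : GL (Fin 2) ℂ) : Matrix (Fin 2) (Fin 2) ℂ)) cw =
      chartOrbHLoc L S w νw (fun k => f ((k : GL (Fin 2) ℂ) : Matrix (Fin 2) (Fin 2) ℂ)) cw -
        ρ (((2 * Real.cosh (cw 0) : ℝ) : ℂ) * Complex.exp ((cw 2 : ℂ) * Complex.I)) * chartOrbHLoc L S w νw (fun k => g ((k : GL (Fin 2) ℂ) : Matrix (Fin 2) (Fin 2) ℂ)) cw := by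
  haveI := locallyCompactSpace_archLocal_two L w
  haveI := secondCountableTopology_archLocal_two L w
  letI : MeasurableSpace (↥(archLocal L 2 (Matrix.of fun i j : Fin 2 => if i.val + j.val + 1 = 2 then (1 : L) else 0) w) ⧸ chartTorusHLoc L S w) := borel _
  haveI : BorelSpace (↥(archLocal L 2 (Matrix.of fun i j : Fin 2 => if i.val + j.val + 1 = 2 then (1 : L) else 0) w) ⧸ chartTorusHLoc L S w) := ⟨rfl⟩
  -- the trace is constant along the class of the chart point
  set t : ℂ := Matrix.trace (((endoBlockAt L S w cw : ↥(archLocal L 2 (Matrix.of fun i j : Fin 2 => if i.val + j.val + 1 = 2 then (1 : L) else 0) w)) : GL (Fin 2) ℂ) : Matrix (Fin 2) (Fin 2) ℂ) with ht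
  have htr : ∀ y : ↥(archLocal L 2 (Matrix.of fun i j : Fin 2 => if i.val + j.val + 1 = 2 then (1 : L) else 0) w),
      Matrix.trace (((y * endoBlockAt L S w cw * y⁻¹ : ↥(archLocal L 2 (Matrix.of fun i j : Fin 2 => if i.val + j.val + 1 = 2 then (1 : L) else 0) w)) : GL (Fin 2) ℂ) : Matrix (Fin 2) (Fin 2) ℂ) = t := by
    intro y
    rw [ht, Subgroup.coe_mul, Subgroup.coe_mul, Subgroup.coe_inv, Units.val_mul, Units.val_mul, Matrix.trace_mul_cycle, ← Units.val_mul, inv_mul_cancel, Units.val_one, Matrix.one_mul]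
  -- the two quotient integrands and their integrability
  set F : ↥(archLocal L 2 (Matrix.of fun i j : Fin 2 => if i.val + j.val + 1 = 2 then (1 : L) else 0) w) → ℂ := fun k => f ((k : GL (Fin 2) ℂ) : Matrix (Fin 2) (Fin 2) ℂ) with hFdef
  set G : ↥(archLocal L 2 (Matrix.of fun i j : Fin 2 => if i.val + j.val + 1 = 2 then (1 : L) else 0) w) → ℂ := fun k => g ((k : GL (Fin 2) ℂ) : Matrix (Fin 2) (Fin 2) ℂ) with hGdef
  have hF : Continuous F := hf.comp (Units.continuous_val.comp continuous_subtype_val)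
  have hG : Continuous G := hg.comp (Units.continuous_val.comp continuous_subtype_val)
  have hJ : ((Matrix.of fun i j : Fin 2 => if i.val + j.val + 1 = 2 then (1 : L) else 0).map w.1.embedding) = (StdForm.antidiagonal 2).over ℂ := by
    rw [Literature.NumberTheory.Rogawski1990.antidiagOne_map, StdForm.over_antidiagonal_eq]
  have hFc : HasCompactSupport F := hasCompactSupport_comp_coe hJ f hfc
  have hGc : HasCompactSupport G := hasCompactSupport_comp_coe hJ g hgc
  have hintF : Integrable (descConj (endoBlockAt L S w cw) (chartTorusHLoc L S w) (forall_mem_chartTorusHLoc_comm L S w cw) F) (chartQuotientMeasureHLoc L S w νw) := by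
    haveI : IsFiniteMeasureOnCompacts (chartQuotientMeasureHLoc L S w νw) := by unfold chartQuotientMeasureHLoc; infer_instance
    exact (continuous_descConj _ _ _ hF).integrable_of_hasCompactSupport (hasCompactSupport_descConj_endoBlockAt_of_mem L S w hw hx F hFc)
  have hintG : Integrable (descConj (endoBlockAt L S w cw) (chartTorusHLoc L S w) (forall_mem_chartTorusHLoc_comm L S w cw) G) (chartQuotientMeasureHLoc L S w νw) := by
    haveI : IsFiniteMeasureOnCompacts (chartQuotientMeasureHLoc L S w νw) := by unfold chartQuotientMeasureHLoc; infer_instance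
    exact (continuous_descConj _ _ _ hG).integrable_of_hasCompactSupport (hasCompactSupport_descConj_endoBlockAt_of_mem L S w hw hx G hGc)
  have hcomb : descConj (endoBlockAt L S w cw) (chartTorusHLoc L S w) (forall_mem_chartTorusHLoc_comm L S w cw)
        (fun k => f ((k : GL (Fin 2) ℂ) : Matrix (Fin 2) (Fin 2) ℂ) - ρ (Matrix.trace ((k : GL (Fin 2) ℂ) : Matrix (Fin 2) (Fin 2) ℂ)) * g ((k : GL (Fin 2) ℂ) : Matrix (Fin 2) (Fin 2) ℂ)) =
      fun y => descConj (endoBlockAt L S w cw) (chartTorusHLoc L S w) (forall_mem_chartTorusHLoc_comm L S w cw) F y -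
        ρ t * descConj (endoBlockAt L S w cw) (chartTorusHLoc L S w) (forall_mem_chartTorusHLoc_comm L S w cw) G y := by
    funext y
    induction y using QuotientGroup.induction_on with
    | H k => simp only [descConj_mk, hFdef, hGdef, htr k]
  rw [chartOrbHLoc_def, chartOrbHLoc_def, chartOrbHLoc_def, hcomb, integral_sub hintF (hintG.const_mul _), integral_const_mul, ht, trace_coe_endoBlockAt_of_mem L S hw cw]
  ring

end Reading

end Literature.NumberTheory.Rogawski1990

end
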